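import Summits.AtomisticToContinuum.FouriersLaw.Theorems.ClosedConeSensitivity.Negative.ZeroFrictionDictionary
import Summits.AtomisticToContinuum.FouriersLaw.Theorems.OddSectorIrreversibilitySubBallisticWindowCoboundaryCeiling
import Summits.AtomisticToContinuum.FouriersLaw.Theorems.OddSectorIrreversibilitySubBallisticWindowGibbsPoincare
import Summits.AtomisticToContinuum.FouriersLaw.Theorems.OddSectorIrreversibilitySubBallisticWindowGibbsMoments
import Summits.AtomisticToContinuum.FouriersLaw.Theorems.OddSectorIrreversibilitySubBallisticWindowStaticCurrentBound
import Summits.AtomisticToContinuum.FouriersLaw.Theorems.OddSectorIrreversibilitySubBallisticWindowRampCorrector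
import Literature.MathematicalPhysics.KineticTheory.PhaseSpacePoisson

/-!
# `SubBallisticWindow` (stmt-AtomisticToContinuum-14070), line `Sketch`: the unconditional part and the reduction

Support file for crux `Summit.AtomisticToContinuum.FouriersLaw.Theses.OddSectorIrreversibility.SubBallisticWindow`
(E2 of route OddSectorIrreversibility).  The line `Sketch` (coboundary–Thomson ceiling, skeleton
`Cruxes/SubBallisticWindow/Lines/Sketch.lean` v5) has five of its six registered stubs LANDED
(`…SubBallisticWindow.CoboundaryCeiling.stub_coboundaryCeiling`, `…GibbsPoincare.stub_gibbsPoincare`,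
`…GibbsMoments.stub_gibbsMoments`, `…StaticCurrentBound.stub_staticCurrentBound`,
`…RampCorrector.stub_rampCorrector`).  This file assembles what those five theorems give UNCONDITIONALLY and
`N`-uniformly for the CLOSED pinned anharmonic chain `pinnedChain ω₂ lam β γ` (`ω₂ > 0`, `lam, β ≥ 0`, any `γ`,
`T > 0`; closed kernels `(pinnedChain ω₂ lam β 0).transitionKernel` = Dirac masses at the Hamiltonian flow),
all in the crux's own vocabulary (`V_B(τ) = ∫ (∫_{(0,τ]} (P⁰_t J_B)(x) dt)² e^{-H(x)/T} dx`, `ℓ = k₂ - k₁`,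
`Z = ∫ e^{-H/T}`):

* `ballisticEnvelope` — `∃ C ∀ N, k₁ ≤ k₂, k₂ + 1 ≤ N, τ ≥ 0: V_B(τ) ≤ C ℓ² (ℓ + τ) Z` (the harmonic /
  ballistic law, uniformly in `N`, block and window);
* `shortWindows` — E2 on windows `τ ≤ 1`: `V_B(τ) ≤ C (1 + τ) ℓ Z`;
* `boundedBlocks` — E2 for blocks of length `≤ ℓ₀`: `∀ ℓ₀ ∃ C …, V_B(τ) ≤ C (1 + τ) ℓ Z` for all `τ ≥ 0`, all `N`;
* `singleBond` — the case `ℓ₀ = 1` written for one bond current `j_i`: `∫ (∫_{(0,τ]} j_i∘Φ_t dt)² dμ_T ≤ C (1+τ) Z`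
  for every `N`, every bond `i ≤ N - 2`, every `τ ≥ 0` (a windowed Green–Kubo second-moment ceiling for ONE bond of the
  deterministic anharmonic chain, uniform in the volume);
* `subBallisticWindow_of_correctorFamily` — the REDUCTION: the crux follows from the one remaining registered stub
  `stub_correctorFamily` (E2 on `ℓ ≥ 2`, `τ ≥ 1` in flow-free Thomson form: SOME `G ∈ C²` with
  `8 ∫ (G - c)² dμ_T + 2 τ² ∫ (J_B - {H,G})² dμ_T ≤ C (1+τ) ℓ Z`), taken as an explicit hypothesis.

Not here: the corrector family itself (the open `N`-uniform content of E2: beat the energy ramp by a factor `ℓ`).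
-/

noncomputable section

namespace Summit.AtomisticToContinuum.FouriersLaw.Theorems.SubBallisticWindow.Partial

open MeasureTheory Filter Topology Set
open scoped NNReal ENNReal
open Literature.MathematicalPhysics.KineticTheory.HeatConduction
open Summit.AtomisticToContinuum.FouriersLaw.Theorems.ClosedConeSensitivity.Negative.ZeroFrictionDictionary
open Summit.AtomisticToContinuum.FouriersLaw.Theorems.OddSectorWitness
open Summit.AtomisticToContinuum.FouriersLaw.Theses.OddSectorIrreversibility

/-! ## Small glue -/

/-- `{f, 0} = 0` as functions. [folklore] -/
theorem poisson_zero_right {N : ℕ} (f : PhaseSpace N → ℝ) : poisson f (fun _ => (0 : ℝ)) = fun _ => 0 :=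
  funext fun z => poisson_const_right f 0 z

/-- The Dirac dictionary for the crux's left-hand side: for the closed chain the kernel average of the block
current is its value along the Hamiltonian flow, so the windowed transport is `∫_{(0,τ]} J_B(Φ_t x) dt`. [folklore] -/
theorem integral_window_kernel_eq {ω₂ lam β : ℝ} (hω : 0 < ω₂) (hl : 0 ≤ lam) (hβ : 0 ≤ β) (γ : ℝ)
    (N k₁ k₂ : ℕ) (T τ : ℝ) (μ : Measure (PhaseSpace N)) :
    ∫ x, (∫ t in Ioc (0 : ℝ) τ, (∫ y, blockCurrent ω₂ lam β γ N k₁ k₂ y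
        ∂((pinnedChain ω₂ lam β 0).transitionKernel N T T t.toNNReal x))) ^ 2 ∂μ =
      ∫ x, (∫ t in Ioc (0 : ℝ) τ, blockCurrent ω₂ lam β γ N k₁ k₂ (detFlow ω₂ lam β N t x)) ^ 2 ∂μ := by
  refine integral_congr_ae (Eventually.of_forall fun x => ?_)
  simp only
  congr 1
  refine setIntegral_congr_fun measurableSet_Ioc fun t ht => ?_
  rw [integral_transitionKernel_zero_friction hω hl hβ, Real.coe_toNNReal _ ht.1.le]

/-! ## The two unconditional envelopes (static and ballistic), `N`-uniform -/

/-- **The two envelopes.** For `ω₂ > 0`, `lam, β ≥ 0`, any `γ`, `T > 0` there are `C_J, C_E ≥ 0` with, for every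
`N`, block `k₁ ≤ k₂` and window: (static) `V_B(τ) ≤ 2 τ² C_J ℓ Z` for all `τ ≥ 0` (`G = 0` in the Thomson
inequality and the static current bound), and (ballistic) `V_B(τ) ≤ C_E ℓ² (ℓ + τ) Z` for `τ ≥ 1`, `k₂ + 1 ≤ N`
(the return-ramp corrector). Here `V_B(τ) = ∫ (∫_{(0,τ]} J_B(Φ_t x) dt)² dμ_T`. [folklore] -/
theorem exists_envelopes {ω₂ lam β : ℝ} (hω : 0 < ω₂) (hl : 0 ≤ lam) (hβ : 0 ≤ β) (γ : ℝ) {T : ℝ}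
    (hT : 0 < T) :
    ∃ CJ CE : ℝ, 0 ≤ CJ ∧ 0 ≤ CE ∧
      (∀ (N k₁ k₂ : ℕ), k₁ ≤ k₂ → ∀ τ : ℝ, 0 ≤ τ →
        ∫ x, (∫ t in Ioc (0 : ℝ) τ, blockCurrent ω₂ lam β γ N k₁ k₂ (detFlow ω₂ lam β N t x)) ^ 2
            ∂(gibbsWeight ω₂ lam β γ N T) ≤
          2 * τ ^ 2 * (CJ * ((k₂ : ℝ) - k₁) *
            ∫ x : PhaseSpace N, Real.exp (-((pinnedChain ω₂ lam β γ).hamiltonian N x) / T))) ∧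
      (∀ (N k₁ k₂ : ℕ), k₁ ≤ k₂ → k₂ + 1 ≤ N → ∀ τ : ℝ, 1 ≤ τ →
        ∫ x, (∫ t in Ioc (0 : ℝ) τ, blockCurrent ω₂ lam β γ N k₁ k₂ (detFlow ω₂ lam β N t x)) ^ 2
            ∂(gibbsWeight ω₂ lam β γ N T) ≤
          CE * ((k₂ : ℝ) - k₁) ^ 2 * (((k₂ : ℝ) - k₁) + τ) *
            ∫ x : PhaseSpace N, Real.exp (-((pinnedChain ω₂ lam β γ).hamiltonian N x) / T)) := by
  -- the five landed stubs of line `Sketch`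
  have hA := CoboundaryCeiling.stub_coboundaryCeiling ω₂ lam β γ hω hl hβ T hT
  have hP := GibbsPoincare.stub_gibbsPoincare ω₂ lam β γ hω hl hβ T hT
  have hM := GibbsMoments.stub_gibbsMoments ω₂ lam β γ hω hl hβ T hT hP
  have hJ' := StaticCurrentBound.stub_staticCurrentBound ω₂ lam β γ hω hl hβ T hT hM
  obtain ⟨CE, hE⟩ := RampCorrector.stub_rampCorrector ω₂ lam β γ hω hl hβ T hT hP hM hJ'
  obtain ⟨CJ, hJ⟩ := hJ'
  refine ⟨max CJ 0, max CE 0, le_max_right _ _, le_max_right _ _, ?_, ?_⟩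
  · intro N k₁ k₂ hk τ hτ
    haveI := isFiniteMeasure_gibbsWeight hω hl hβ γ N hT
    set Z := ∫ y, Real.exp (-((pinnedChain ω₂ lam β γ).hamiltonian N y) / T) ∂volume with hZ
    have hZ0 : 0 ≤ Z := integral_nonneg fun _ => (Real.exp_pos _).le
    have hℓ0 : (0 : ℝ) ≤ (k₂ : ℝ) - k₁ := sub_nonneg.mpr (by exact_mod_cast hk)
    have hG0 : ContDiff ℝ 2 (fun _ : PhaseSpace N => (0 : ℝ)) := contDiff_const
    have hG0L : MemLp (fun _ : PhaseSpace N => (0 : ℝ)) 2 (gibbsWeight ω₂ lam β γ N T) := memLp_const 0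
    have hPG0 : MemLp (poisson ((pinnedChain ω₂ lam β γ).hamiltonian N)
        (fun _ : PhaseSpace N => (0 : ℝ))) 2 (gibbsWeight ω₂ lam β γ N T) := by
      rw [poisson_zero_right]
      exact hG0L
    have h1 := hA N k₁ k₂ τ hτ (fun _ => 0) 0 hG0 hG0L hPG0
    have h2 := hJ N k₁ k₂ hk
    simp only [poisson_zero_right, sub_zero] at h1
    have h3 : ∫ _x, (0 : ℝ) ^ 2 ∂(gibbsWeight ω₂ lam β γ N T) = 0 := by simp
    rw [show (volume.withDensity fun x : PhaseSpace N =>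
        ENNReal.ofReal (Real.exp (-((pinnedChain ω₂ lam β γ).hamiltonian N x) / T))) =
        gibbsWeight ω₂ lam β γ N T from rfl, h3, mul_zero, zero_add] at h1
    calc ∫ x, (∫ t in Ioc (0 : ℝ) τ, blockCurrent ω₂ lam β γ N k₁ k₂ (detFlow ω₂ lam β N t x)) ^ 2
            ∂(gibbsWeight ω₂ lam β γ N T)
        ≤ 2 * τ ^ 2 * ∫ x, (blockCurrent ω₂ lam β γ N k₁ k₂ x) ^ 2 ∂(gibbsWeight ω₂ lam β γ N T) := h1
      _ ≤ 2 * τ ^ 2 * (max CJ 0 * ((k₂ : ℝ) - k₁) * Z) := by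
          refine mul_le_mul_of_nonneg_left (h2.trans ?_) (by positivity)
          exact mul_le_mul_of_nonneg_right (mul_le_mul_of_nonneg_right (le_max_left _ _) hℓ0) hZ0
  · intro N k₁ k₂ hk hkN τ hτ
    set Z := ∫ y, Real.exp (-((pinnedChain ω₂ lam β γ).hamiltonian N y) / T) ∂volume with hZ
    have hZ0 : 0 ≤ Z := integral_nonneg fun _ => (Real.exp_pos _).le
    obtain ⟨G, c, hG, hGL, hPG, hbound⟩ := hE N k₁ k₂ hk hkN τ hτ
    have h1 := hA N k₁ k₂ τ (by linarith) G c hG hGL hPG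
    calc ∫ x, (∫ t in Ioc (0 : ℝ) τ, blockCurrent ω₂ lam β γ N k₁ k₂ (detFlow ω₂ lam β N t x)) ^ 2
            ∂(gibbsWeight ω₂ lam β γ N T)
        ≤ CE * ((k₂ : ℝ) - k₁) ^ 2 * (((k₂ : ℝ) - k₁) + τ) * Z := h1.trans hbound
      _ = CE * (((k₂ : ℝ) - k₁) ^ 2 * (((k₂ : ℝ) - k₁) + τ) * Z) := by ring
      _ ≤ max CE 0 * (((k₂ : ℝ) - k₁) ^ 2 * (((k₂ : ℝ) - k₁) + τ) * Z) := by
          refine mul_le_mul_of_nonneg_right (le_max_left _ _) ?_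
          have : 0 ≤ ((k₂ : ℝ) - k₁) + τ := by
            have : (0 : ℝ) ≤ (k₂ : ℝ) - k₁ := sub_nonneg.mpr (by exact_mod_cast hk)
            linarith
          positivity
      _ = _ := by ring

/-! ## Headline unconditional theorems in the crux's vocabulary -/

/-- **Ballistic envelope** (`N`-uniform; the harmonic law). For `ω₂ > 0`, `lam, β ≥ 0`, any `γ`, `T > 0` there is
`C` with, for every `N`, block `[k₁,k₂)` (`k₂ + 1 ≤ N`) and window `τ ≥ 0`,
`∫ (∫_{(0,τ]} (P⁰_t J_B)(x) dt)² e^{-H(x)/T} dx ≤ C (k₂-k₁)² ((k₂-k₁) + τ) Z`, `P⁰_t` the closed kernels. For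
`τ ≤ 1` this is the static envelope (`τ² ℓ ≤ ℓ²(ℓ+τ)` as `ℓ ≥ 1` or `ℓ = 0`), for `τ ≥ 1` the return ramp. [folklore] -/
theorem ballisticEnvelope :
    ∀ ω₂ lam β γ : ℝ, 0 < ω₂ → 0 ≤ lam → 0 ≤ β → ∀ T : ℝ, 0 < T → ∃ C : ℝ, ∀ (N k₁ k₂ : ℕ), k₁ ≤ k₂ →
      k₂ + 1 ≤ N → ∀ τ : ℝ, 0 ≤ τ →
      let P := pinnedChain ω₂ lam β γ;
      let P₀ := pinnedChain ω₂ lam β 0;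
      let μT : Measure (PhaseSpace N) :=
        volume.withDensity (fun x : PhaseSpace N => ENNReal.ofReal (Real.exp (-(P.hamiltonian N x) / T)));
      let JB : PhaseSpace N → ℝ := fun z => ∑ i : Fin N,
        (if k₁ ≤ i.val ∧ i.val < k₂ then P.bondCurrent N i z else 0);
      ∫ x, (∫ t in Set.Ioc (0 : ℝ) τ, (∫ y, JB y ∂(P₀.transitionKernel N T T t.toNNReal x))) ^ 2 ∂μT ≤
        C * ((k₂ : ℝ) - k₁) ^ 2 * (((k₂ : ℝ) - k₁) + τ) * ∫ x, Real.exp (-(P.hamiltonian N x) / T) ∂volume := by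
  intro ω₂ lam β γ hω hl hβ T hT
  obtain ⟨CJ, CE, hCJ0, hCE0, hstat, hramp⟩ := exists_envelopes hω hl hβ γ hT
  refine ⟨2 * CJ + CE, fun N k₁ k₂ hk hkN τ hτ => ?_⟩
  simp only
  set Z := ∫ y, Real.exp (-((pinnedChain ω₂ lam β γ).hamiltonian N y) / T) ∂volume with hZ
  have hZ0 : 0 ≤ Z := integral_nonneg fun _ => (Real.exp_pos _).le
  have hℓ0 : (0 : ℝ) ≤ (k₂ : ℝ) - k₁ := sub_nonneg.mpr (by exact_mod_cast hk)
  have hdict := integral_window_kernel_eq hω hl hβ γ N k₁ k₂ T τ (gibbsWeight ω₂ lam β γ N T)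
  simp only [blockCurrent] at hdict
  rw [show (volume.withDensity fun x : PhaseSpace N =>
      ENNReal.ofReal (Real.exp (-((pinnedChain ω₂ lam β γ).hamiltonian N x) / T))) =
      gibbsWeight ω₂ lam β γ N T from rfl, hdict]
  have henv0 : 0 ≤ ((k₂ : ℝ) - k₁) ^ 2 * (((k₂ : ℝ) - k₁) + τ) * Z := by positivity
  rcases le_or_gt τ 1 with hτ1 | hτ1
  · have h1 := hstat N k₁ k₂ hk τ hτ
    simp only [blockCurrent] at h1
    refine h1.trans ?_
    -- `2 τ² C_J ℓ Z ≤ (2 C_J + C_E) ℓ² (ℓ + τ) Z`: `τ² ℓ ≤ ℓ² (ℓ + τ)` since `ℓ = 0` or `ℓ ≥ 1 ≥ τ`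
    have hkey : τ ^ 2 * ((k₂ : ℝ) - k₁) ≤ ((k₂ : ℝ) - k₁) ^ 2 * (((k₂ : ℝ) - k₁) + τ) := by
      rcases Nat.eq_or_lt_of_le hk with h | h
      · subst h
        simp
      · have hℓ1 : (1 : ℝ) ≤ (k₂ : ℝ) - k₁ := by
          have : (k₁ : ℝ) + 1 ≤ k₂ := by exact_mod_cast h
          linarith
        have hτ2 : τ ^ 2 ≤ 1 := by nlinarith
        calc τ ^ 2 * ((k₂ : ℝ) - k₁) ≤ 1 * ((k₂ : ℝ) - k₁) :=
              mul_le_mul_of_nonneg_right hτ2 hℓ0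
          _ ≤ ((k₂ : ℝ) - k₁) ^ 2 * (((k₂ : ℝ) - k₁) + τ) := by nlinarith
    calc 2 * τ ^ 2 * (CJ * ((k₂ : ℝ) - k₁) * Z) = 2 * CJ * (τ ^ 2 * ((k₂ : ℝ) - k₁)) * Z := by ring
      _ ≤ 2 * CJ * (((k₂ : ℝ) - k₁) ^ 2 * (((k₂ : ℝ) - k₁) + τ)) * Z := by gcongr
      _ ≤ (2 * CJ + CE) * ((k₂ : ℝ) - k₁) ^ 2 * (((k₂ : ℝ) - k₁) + τ) * Z := by nlinarith
  · have h1 := hramp N k₁ k₂ hk hkN τ hτ1.le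
    simp only [blockCurrent] at h1
    refine h1.trans ?_
    nlinarith

/-- **E2 on short windows** (`N`-uniform). For `ω₂ > 0`, `lam, β ≥ 0`, any `γ`, `T > 0` there is `C` with, for
every `N`, block `k₁ ≤ k₂` and window `0 ≤ τ ≤ 1`,
`∫ (∫_{(0,τ]} (P⁰_t J_B)(x) dt)² e^{-H(x)/T} dx ≤ C (1 + τ) (k₂ - k₁) Z` — the crux inequality restricted to
`τ ≤ 1` (static envelope, `τ² ≤ 1 + τ`). [folklore] -/
theorem shortWindows :
    ∀ ω₂ lam β γ : ℝ, 0 < ω₂ → 0 ≤ lam → 0 ≤ β → ∀ T : ℝ, 0 < T → ∃ C : ℝ, ∀ (N k₁ k₂ : ℕ), k₁ ≤ k₂ →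
      ∀ τ : ℝ, 0 ≤ τ → τ ≤ 1 →
      let P := pinnedChain ω₂ lam β γ;
      let P₀ := pinnedChain ω₂ lam β 0;
      let μT : Measure (PhaseSpace N) :=
        volume.withDensity (fun x : PhaseSpace N => ENNReal.ofReal (Real.exp (-(P.hamiltonian N x) / T)));
      let JB : PhaseSpace N → ℝ := fun z => ∑ i : Fin N,
        (if k₁ ≤ i.val ∧ i.val < k₂ then P.bondCurrent N i z else 0);
      ∫ x, (∫ t in Set.Ioc (0 : ℝ) τ, (∫ y, JB y ∂(P₀.transitionKernel N T T t.toNNReal x))) ^ 2 ∂μT ≤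
        C * (1 + τ) * ((k₂ : ℝ) - k₁) * ∫ x, Real.exp (-(P.hamiltonian N x) / T) ∂volume := by
  intro ω₂ lam β γ hω hl hβ T hT
  obtain ⟨CJ, CE, hCJ0, -, hstat, -⟩ := exists_envelopes hω hl hβ γ hT
  refine ⟨2 * CJ, fun N k₁ k₂ hk τ hτ hτ1 => ?_⟩
  simp only
  set Z := ∫ y, Real.exp (-((pinnedChain ω₂ lam β γ).hamiltonian N y) / T) ∂volume with hZ
  have hZ0 : 0 ≤ Z := integral_nonneg fun _ => (Real.exp_pos _).le
  have hℓ0 : (0 : ℝ) ≤ (k₂ : ℝ) - k₁ := sub_nonneg.mpr (by exact_mod_cast hk)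
  have hdict := integral_window_kernel_eq hω hl hβ γ N k₁ k₂ T τ (gibbsWeight ω₂ lam β γ N T)
  simp only [blockCurrent] at hdict
  rw [show (volume.withDensity fun x : PhaseSpace N =>
      ENNReal.ofReal (Real.exp (-((pinnedChain ω₂ lam β γ).hamiltonian N x) / T))) =
      gibbsWeight ω₂ lam β γ N T from rfl, hdict]
  have h1 := hstat N k₁ k₂ hk τ hτ
  simp only [blockCurrent] at h1
  refine h1.trans ?_
  have hτ2 : τ ^ 2 ≤ 1 + τ := by nlinarith
  have h0 : 0 ≤ CJ * ((k₂ : ℝ) - k₁) * Z := by positivity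
  calc 2 * τ ^ 2 * (CJ * ((k₂ : ℝ) - k₁) * Z) ≤ 2 * (1 + τ) * (CJ * ((k₂ : ℝ) - k₁) * Z) := by
        nlinarith
    _ = 2 * CJ * (1 + τ) * ((k₂ : ℝ) - k₁) * Z := by ring

/-- **E2 for blocks of bounded length** (`N`-uniform, all windows). For `ω₂ > 0`, `lam, β ≥ 0`, any `γ`, `T > 0`
and every `ℓ₀` there is `C = C(ℓ₀)` (growing like `ℓ₀²`) with, for every `N`, every block `[k₁,k₂)` of length
`k₂ - k₁ ≤ ℓ₀` (`k₂ + 1 ≤ N`) and every `τ ≥ 0`,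
`∫ (∫_{(0,τ]} (P⁰_t J_B)(x) dt)² e^{-H(x)/T} dx ≤ C (1 + τ) (k₂ - k₁) Z` — the crux inequality for bounded
blocks, from the ballistic envelope (`ℓ²(ℓ+τ) ≤ ℓ (ℓ₀+1)² (1+τ)`). [folklore] -/
theorem boundedBlocks :
    ∀ ω₂ lam β γ : ℝ, 0 < ω₂ → 0 ≤ lam → 0 ≤ β → ∀ T : ℝ, 0 < T → ∀ ℓ₀ : ℕ, ∃ C : ℝ, ∀ (N k₁ k₂ : ℕ),
      k₁ ≤ k₂ → k₂ ≤ k₁ + ℓ₀ → k₂ + 1 ≤ N → ∀ τ : ℝ, 0 ≤ τ →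
      let P := pinnedChain ω₂ lam β γ;
      let P₀ := pinnedChain ω₂ lam β 0;
      let μT : Measure (PhaseSpace N) :=
        volume.withDensity (fun x : PhaseSpace N => ENNReal.ofReal (Real.exp (-(P.hamiltonian N x) / T)));
      let JB : PhaseSpace N → ℝ := fun z => ∑ i : Fin N,
        (if k₁ ≤ i.val ∧ i.val < k₂ then P.bondCurrent N i z else 0);
      ∫ x, (∫ t in Set.Ioc (0 : ℝ) τ, (∫ y, JB y ∂(P₀.transitionKernel N T T t.toNNReal x))) ^ 2 ∂μT ≤
        C * (1 + τ) * ((k₂ : ℝ) - k₁) * ∫ x, Real.exp (-(P.hamiltonian N x) / T) ∂volume := by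
  intro ω₂ lam β γ hω hl hβ T hT ℓ₀
  obtain ⟨C, hC⟩ := ballisticEnvelope ω₂ lam β γ hω hl hβ T hT
  refine ⟨max C 0 * ((ℓ₀ : ℝ) + 1) ^ 2, fun N k₁ k₂ hk hkℓ hkN τ hτ => ?_⟩
  have h1 := hC N k₁ k₂ hk hkN τ hτ
  simp only at h1 ⊢
  refine h1.trans ?_
  set Z := ∫ y, Real.exp (-((pinnedChain ω₂ lam β γ).hamiltonian N y) / T) ∂volume with hZ
  have hZ0 : 0 ≤ Z := integral_nonneg fun _ => (Real.exp_pos _).le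
  have hℓ0 : (0 : ℝ) ≤ (k₂ : ℝ) - k₁ := sub_nonneg.mpr (by exact_mod_cast hk)
  have hℓle : (k₂ : ℝ) - k₁ ≤ (ℓ₀ : ℝ) + 1 := by
    have : (k₂ : ℝ) ≤ k₁ + ℓ₀ := by exact_mod_cast hkℓ
    linarith
  have hkey : ((k₂ : ℝ) - k₁) ^ 2 * (((k₂ : ℝ) - k₁) + τ) ≤
      ((ℓ₀ : ℝ) + 1) ^ 2 * ((1 + τ) * ((k₂ : ℝ) - k₁)) := by
    have h2 : ((k₂ : ℝ) - k₁) + τ ≤ ((ℓ₀ : ℝ) + 1) * (1 + τ) := by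
      have : (0 : ℝ) ≤ (ℓ₀ : ℝ) := Nat.cast_nonneg _
      nlinarith
    calc ((k₂ : ℝ) - k₁) ^ 2 * (((k₂ : ℝ) - k₁) + τ)
        = ((k₂ : ℝ) - k₁) * (((k₂ : ℝ) - k₁) * (((k₂ : ℝ) - k₁) + τ)) := by ring
      _ ≤ ((k₂ : ℝ) - k₁) * (((ℓ₀ : ℝ) + 1) * (((ℓ₀ : ℝ) + 1) * (1 + τ))) := by
          refine mul_le_mul_of_nonneg_left ?_ hℓ0
          exact mul_le_mul hℓle h2 (by positivity) (by positivity)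
      _ = ((ℓ₀ : ℝ) + 1) ^ 2 * ((1 + τ) * ((k₂ : ℝ) - k₁)) := by ring
  calc C * ((k₂ : ℝ) - k₁) ^ 2 * (((k₂ : ℝ) - k₁) + τ) * Z
      = C * ((((k₂ : ℝ) - k₁) ^ 2 * (((k₂ : ℝ) - k₁) + τ)) * Z) := by ring
    _ ≤ max C 0 * ((((k₂ : ℝ) - k₁) ^ 2 * (((k₂ : ℝ) - k₁) + τ)) * Z) :=
        mul_le_mul_of_nonneg_right (le_max_left _ _) (by positivity)
    _ ≤ max C 0 * ((((ℓ₀ : ℝ) + 1) ^ 2 * ((1 + τ) * ((k₂ : ℝ) - k₁))) * Z) := by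
        refine mul_le_mul_of_nonneg_left (mul_le_mul_of_nonneg_right hkey hZ0) (le_max_right _ _)
    _ = max C 0 * ((ℓ₀ : ℝ) + 1) ^ 2 * (1 + τ) * ((k₂ : ℝ) - k₁) * Z := by ring

/-- **Single-bond windowed Green–Kubo ceiling** (`N`-uniform). For `ω₂ > 0`, `lam, β ≥ 0`, any `γ`, `T > 0` there
is `C` with, for every `N`, every bond `i` with `i + 2 ≤ N` and every `τ ≥ 0`,
`∫ (∫_{(0,τ]} (P⁰_t j_i)(x) dt)² e^{-H(x)/T} dx ≤ C (1 + τ) Z`: the time-integrated energy current through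
ONE bond of the closed (deterministic) pinned anharmonic chain at equilibrium has second moment growing at most
linearly in the window, uniformly in the volume and the position of the bond (the block `[i, i+1)` of
`boundedBlocks`). [folklore] -/
theorem singleBond :
    ∀ ω₂ lam β γ : ℝ, 0 < ω₂ → 0 ≤ lam → 0 ≤ β → ∀ T : ℝ, 0 < T → ∃ C : ℝ, ∀ (N : ℕ) (i : Fin N),
      i.val + 2 ≤ N → ∀ τ : ℝ, 0 ≤ τ →
      let P := pinnedChain ω₂ lam β γ;
      let P₀ := pinnedChain ω₂ lam β 0;
      let μT : Measure (PhaseSpace N) :=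
        volume.withDensity (fun x : PhaseSpace N => ENNReal.ofReal (Real.exp (-(P.hamiltonian N x) / T)));
      ∫ x, (∫ t in Set.Ioc (0 : ℝ) τ,
          (∫ y, P.bondCurrent N i y ∂(P₀.transitionKernel N T T t.toNNReal x))) ^ 2 ∂μT ≤
        C * (1 + τ) * ∫ x, Real.exp (-(P.hamiltonian N x) / T) ∂volume := by
  intro ω₂ lam β γ hω hl hβ T hT
  obtain ⟨C, hC⟩ := boundedBlocks ω₂ lam β γ hω hl hβ T hT 1
  refine ⟨C, fun N i hi τ hτ => ?_⟩
  have h1 := hC N i.val (i.val + 1) (Nat.le_succ _) le_rfl (by omega) τ hτ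
  simp only at h1 ⊢
  have hJ : (fun z : PhaseSpace N => ∑ i' : Fin N,
      (if i.val ≤ i'.val ∧ i'.val < i.val + 1 then (pinnedChain ω₂ lam β γ).bondCurrent N i' z else 0)) =
      (pinnedChain ω₂ lam β γ).bondCurrent N i := by
    funext z
    have hiff : ∀ i' : Fin N, (i.val ≤ i'.val ∧ i'.val < i.val + 1) ↔ i' = i := fun i' => by
      constructor
      · intro h
        exact Fin.ext (by omega)
      · rintro rfl
        exact ⟨le_rfl, Nat.lt_succ_self _⟩
    rw [Finset.sum_congr rfl fun i' _ => if_congr (hiff i') rfl rfl]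
    simp [Finset.sum_ite_eq']
  rw [hJ] at h1
  have hℓ : ((i.val + 1 : ℕ) : ℝ) - (i.val : ℕ) = 1 := by push_cast; ring
  rw [hℓ, mul_one] at h1
  exact h1

/-! ## The reduction: the crux from the corrector family -/

/-- **Reduction of the crux to the corrector family.** If for all `ω₂, lam, β, γ > 0` and `T > 0` there is
`C_F` such that every block of length `ℓ ≥ 2` (`k₂ + 1 ≤ N`) and every window `τ ≥ 1` admit SOME test observable
`G ∈ C²` (with `G, {H,G} ∈ L²(μ_T)`) and constant `c` achieving the Thomson value
`8 ∫ (G - c)² dμ_T + 2 τ² ∫ (J_B - {H,G})² dμ_T ≤ C_F (1+τ) ℓ Z` — the one remaining registered stub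
`stub_correctorFamily` of line `Sketch`, verbatim — then the crux `SubBallisticWindow` holds, with
`C = 2 C_J + C_E + max(C_F, 0)`: windows `τ ≤ 1` by the static envelope, blocks `ℓ ≤ 1` by the return ramp,
and `ℓ ≥ 2`, `τ ≥ 1` by the hypothesis through the coboundary (Thomson) ceiling. [folklore] -/
theorem subBallisticWindow_of_correctorFamily
    (hF : ∀ ω₂ lam β γ : ℝ, 0 < ω₂ → 0 < lam → 0 < β → 0 < γ → ∀ T : ℝ, 0 < T → ∃ C : ℝ,
      ∀ (N k₁ k₂ : ℕ), k₁ ≤ k₂ → k₁ + 2 ≤ k₂ → k₂ + 1 ≤ N → ∀ τ : ℝ, 1 ≤ τ →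
        ∃ (G : PhaseSpace N → ℝ) (c : ℝ), ContDiff ℝ 2 G ∧
          MemLp G 2 (volume.withDensity fun x : PhaseSpace N =>
            ENNReal.ofReal (Real.exp (-((pinnedChain ω₂ lam β γ).hamiltonian N x) / T))) ∧
          MemLp (poisson ((pinnedChain ω₂ lam β γ).hamiltonian N) G) 2
            (volume.withDensity fun x : PhaseSpace N =>
              ENNReal.ofReal (Real.exp (-((pinnedChain ω₂ lam β γ).hamiltonian N x) / T))) ∧
          8 * ∫ x, (G x - c) ^ 2
              ∂(volume.withDensity fun x : PhaseSpace N =>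
                ENNReal.ofReal (Real.exp (-((pinnedChain ω₂ lam β γ).hamiltonian N x) / T))) +
            2 * τ ^ 2 * ∫ x,
              ((fun z : PhaseSpace N => ∑ i : Fin N, (if k₁ ≤ i.val ∧ i.val < k₂ then
                  (pinnedChain ω₂ lam β γ).bondCurrent N i z else 0)) x
                - poisson ((pinnedChain ω₂ lam β γ).hamiltonian N) G x) ^ 2
              ∂(volume.withDensity fun x : PhaseSpace N =>
                ENNReal.ofReal (Real.exp (-((pinnedChain ω₂ lam β γ).hamiltonian N x) / T))) ≤
            C * (1 + τ) * ((k₂ : ℝ) - k₁) *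
              (∫ x : PhaseSpace N, Real.exp (-((pinnedChain ω₂ lam β γ).hamiltonian N x) / T))) :
    SubBallisticWindow := by
  intro ω₂ lam β γ hω hl hβ hγ T hT
  obtain ⟨CJ, CE, hCJ0, hCE0, hstat, hramp⟩ := exists_envelopes hω hl.le hβ.le γ hT
  have hA := CoboundaryCeiling.stub_coboundaryCeiling ω₂ lam β γ hω hl.le hβ.le T hT
  obtain ⟨CF, hF'⟩ := hF ω₂ lam β γ hω hl hβ hγ T hT
  obtain ⟨C1, hC1⟩ := shortWindows ω₂ lam β γ hω hl.le hβ.le T hT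
  obtain ⟨C2, hC2⟩ := boundedBlocks ω₂ lam β γ hω hl.le hβ.le T hT 1
  refine ⟨max C1 0 + max C2 0 + max CF 0, fun N k₁ k₂ hk hkN τ hτ => ?_⟩
  simp only
  set Z := ∫ y, Real.exp (-((pinnedChain ω₂ lam β γ).hamiltonian N y) / T) ∂volume with hZ
  have hZ0 : 0 ≤ Z := integral_nonneg fun _ => (Real.exp_pos _).le
  have hℓ0 : (0 : ℝ) ≤ (k₂ : ℝ) - k₁ := sub_nonneg.mpr (by exact_mod_cast hk)
  have hW0 : 0 ≤ (1 + τ) * ((k₂ : ℝ) - k₁) * Z := by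
    have : 0 ≤ 1 + τ := by linarith
    positivity
  have hC10 : 0 ≤ max C1 0 := le_max_right _ _
  have hC20 : 0 ≤ max C2 0 := le_max_right _ _
  have hCF0 : 0 ≤ max CF 0 := le_max_right _ _
  -- a bound by `K · envelope` with `K ≤` the total constant suffices
  have hsum : ∀ {X K : ℝ}, X ≤ K * ((1 + τ) * ((k₂ : ℝ) - k₁) * Z) →
      K ≤ max C1 0 + max C2 0 + max CF 0 →
      X ≤ (max C1 0 + max C2 0 + max CF 0) * (1 + τ) * ((k₂ : ℝ) - k₁) * Z := by
    intro X K h hK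
    calc X ≤ K * ((1 + τ) * ((k₂ : ℝ) - k₁) * Z) := h
      _ ≤ (max C1 0 + max C2 0 + max CF 0) * ((1 + τ) * ((k₂ : ℝ) - k₁) * Z) :=
          mul_le_mul_of_nonneg_right hK hW0
      _ = _ := by ring
  rcases le_or_gt τ 1 with hτ1 | hτ1
  · -- short windows
    have h1 := hC1 N k₁ k₂ hk τ hτ hτ1
    simp only at h1
    refine hsum (K := max C1 0) (h1.trans ?_) (by linarith)
    calc C1 * (1 + τ) * ((k₂ : ℝ) - k₁) * Z = C1 * ((1 + τ) * ((k₂ : ℝ) - k₁) * Z) := by ring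
      _ ≤ max C1 0 * ((1 + τ) * ((k₂ : ℝ) - k₁) * Z) := mul_le_mul_of_nonneg_right (le_max_left _ _) hW0
  · rcases le_or_gt k₂ (k₁ + 1) with hℓ1 | hℓ2
    · -- blocks of length ≤ 1
      have h1 := hC2 N k₁ k₂ hk hℓ1 hkN τ hτ
      simp only at h1
      refine hsum (K := max C2 0) (h1.trans ?_) (by linarith)
      calc C2 * (1 + τ) * ((k₂ : ℝ) - k₁) * Z = C2 * ((1 + τ) * ((k₂ : ℝ) - k₁) * Z) := by ring
        _ ≤ max C2 0 * ((1 + τ) * ((k₂ : ℝ) - k₁) * Z) := mul_le_mul_of_nonneg_right (le_max_left _ _) hW0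
    · -- long windows, blocks of length ≥ 2: the corrector family through the coboundary ceiling
      have hk2 : k₁ + 2 ≤ k₂ := by omega
      obtain ⟨G, c, hG, hGL, hPG, hbound⟩ := hF' N k₁ k₂ hk hk2 hkN τ hτ1.le
      have hdict := integral_window_kernel_eq hω hl.le hβ.le γ N k₁ k₂ T τ (gibbsWeight ω₂ lam β γ N T)
      simp only [blockCurrent] at hdict
      rw [show (volume.withDensity fun x : PhaseSpace N =>
          ENNReal.ofReal (Real.exp (-((pinnedChain ω₂ lam β γ).hamiltonian N x) / T))) =
          gibbsWeight ω₂ lam β γ N T from rfl, hdict]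
      have h1 := hA N k₁ k₂ τ hτ G c hG hGL hPG
      refine hsum (K := max CF 0) ?_ (by linarith)
      calc ∫ x, (∫ t in Ioc (0 : ℝ) τ, (fun z : PhaseSpace N => ∑ i : Fin N,
              (if k₁ ≤ i.val ∧ i.val < k₂ then (pinnedChain ω₂ lam β γ).bondCurrent N i z else 0))
                (detFlow ω₂ lam β N t x)) ^ 2 ∂(gibbsWeight ω₂ lam β γ N T)
          ≤ CF * (1 + τ) * ((k₂ : ℝ) - k₁) * Z := h1.trans hbound
        _ = CF * ((1 + τ) * ((k₂ : ℝ) - k₁) * Z) := by ring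
        _ ≤ max CF 0 * ((1 + τ) * ((k₂ : ℝ) - k₁) * Z) := mul_le_mul_of_nonneg_right (le_max_left _ _) hW0

end Summit.AtomisticToContinuum.FouriersLaw.Theorems.SubBallisticWindow.Partial

end
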